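import Summits.QuantumFields.YangMills.Theorems.BalabanUVNodesN13U1StepMajorantTowerAtRecord13CoPH
import Summits.QuantumFields.YangMills.Theorems.BalabanUVNodesN13UVRowRFreeAtLiveSelectorRecord13

/-!
# BalabanUVNodes ∕ N13 — THE 𝐑-RATIO ROW OF THE k → k+1 CARVING, BY NAME: `slot_{k+1}(s′) = slotT_{k+1}(s′) · Σ_{a ∈ sel⁻¹ s′} rratio(a, s′)` ([IV] (0.3)), THE TOWER WITH THE
# ROW DISCHARGED BY DEFINITION, AND — AT LIVE-SELECTOR PARAMETERS (dag-n13-w1 g4's `…N13UVRowRFreeAtLiveSelectorRecord13`) — THE TOWER FROM THE 𝐓-STEP ROWS ALONE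
# (Track A, DAG node N13 = [B16]; cluster K1 — K1⁷ `StabilityBAtRecordR13SepCoPH` = stmt-QuantumFields-20542, helper; seat `pub-ymgap-dag-n13-w3` g3, companion of
# `…N13U1StepMajorantTowerAtRecord13CoPH` (p607601); 2026-08-28; count-neutral)

HONEST FRAMING.  Count-neutral kernel BOOKKEEPING; nothing of Bałaban's is asserted.  The companion file carves the Cor-3 upper leaf (U1) along def-T's slot recursion with TWO displayed
per-step rows: the STEP ROW (transported step weight) and the 𝐑-RATIO ROW `|slot_{k+1}(s′)(V′)| ≤ c_R(s′)(V′)·|slotT_{k+1}(s′)(V′)|`.  THIS FILE NAMES THE SECOND ROW'S CONTENT and removes it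
as a hypothesis: (i) [`rfl` through def-T `slotsOfRecord_succ` + def-R `rstepSlotOfRecord` ∕ `rstepSlot` ∕ `rstepOfSel`] the post-𝐑 slot IS the pre-𝐑 slot times the (0.3) RATIO SUM of
def-R's FILE 7 — `slot_{k+1}(s′)(V) = slotT_{k+1}(s′)(V) · Σ_{a : sel(a) = s′} rratio(a, s′)(V)`, `rratio(a, s′) = ∫⌈_{Z′_a} t_a ∕ ∫⌈_{Z′_a} t_{s′}` (selector `sel = θ.ppSel`, fibre bond sets
`fibOfSeq` of record; the `DecidableEq` instance on bonds is def-R's classical one, displayed explicitly so that the identity is literally `rfl`); hence the 𝐑-ratio row HOLDS WITH EQUALITY for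
`c_R(s′)(V) := |Σ_{a : sel(a) = s′} rratio(a, s′)(V)|`, and on a history whose selector fibre is the singleton `{s′}` (nothing merged into it) the sum is `x ∕ x`, `c_R = 1` (§1; the
finer live-selector facts — dead sequences carry zero fibre mass, off-range slots vanish, `ρ_{k+1} ≤ 𝐓ρ_k` — are dag-n13-w1 g4's `rstepOfSel_TexpA_eq_id_of_fix_of_dead` ∕
`rstepOfSel_TexpA_eq_zero_of_forall_sel_ne` ∕ `densOfRecord₁₃_succ_le_tdens_of_liveSel`, CITED, not restated); (ii) THE TOWER WITH THE 𝐑-ROW DISCHARGED (§2, §3): the companion's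
`abs_histTerm_le_of_majorantTower` ∕ `abs_histTerm₁₃_le_of_majorantTower` with that `c_R` — only the base `ρ₀ ≤ M_0` and the STEP ROWS `χ_{j+1}(s′)(V′)·|Σ rratio|(V′)·T_j(|w_j(s′)(·,V′)|·
M_j(init s′))(V′) ≤ M_{j+1}(s′)(V′)` remain (at K1⁷'s record the `w`-rows are `Provisos₁₃CoPH.tstep`); (iii) ★ AT A LIVE-SELECTOR PARAMETER (`θ.ppSel` = K0a's `ppSelLiveOfRecord`, every
`liveRepin₁₃`, every K1 witness of dag-n24-c) the 𝐑-ratio row holds with `c_R = 1` BY dag-n13-w1 g4's `slotsOfRecord₁₃_succ_le_slotsT_of_liveSel` (`0 ≤ slot_{k+1} ≤ slotT_{k+1}` under the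
ζ-laws of `Provisos₁₃CoPH`; slots `≥ 0` by K0's `slotsOfRecord_nonneg` + `wOfRecord₉_nonneg`), so the tower needs the 𝐓-STEP ROWS ALONE: `χ_{j+1}(s′)(V′)·T_j(|w_j(s′)(·,V′)|·M_j(init s′))(V′)
≤ M_{j+1}(s′)(V′)` (§3) — the (U1) leaf at these parameters is priced by the 𝐓-image only, consistent with that file's «NO [IV] (1.1)-type estimate on 𝐑 enters N13's row».
WHAT STAYS DISPLAYED (LOCATED, nobody's theorem here): the size of the ratio sum on RENORMALISED histories at a general selector — [IV] §1's bounds ((0.3) p.176, (1.99)–(1.100) p.201) —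
and the 𝐓-step rows ([III] §3 ∕ (2.49) first term p.264, [B16] (1.89) p.387).  VERSION CAVEAT (def-T FILE 1; dag-n13-w1 g4 §5): every row is pointwise in `V′` for the tree's FIXED
version of the one-step conditional kernel ∕ marginal density, as every pointwise (0.1) reading in the tree.  (U1) NOT proved; [III] Cor. 3 NOT proved; N13 NOT discharged; K0⁷ ∕ K1⁷ NOT
closed; counts unmoved (discharged 5∕27 · Track A 5∕28).  ONE finite four-torus programme at fixed `ε = L^{−K}`; R4 closes the conditional finite-𝕋⁴ rung `BalabanLadder.UV` only — the
Yang–Mills mass gap (Clay) is NOT proved by any of this; nothing continuum ∕ ℝ⁴ ∕ OS.  No `sorry`, `def`, `instance`, `notation`.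

Sources: [Balaban1989LargeFieldI] (0.2)–(0.4) p.176, p.177 (i)–(ii), (1.99)–(1.100) p.201; [Balaban1988Convergent] (2.18) p.257, Thm 1 p.262 («𝐑ρ has again the form (2.18)»), (2.49) p.264,
(3.24)–(3.25) p.270; [Balaban1989LargeFieldII] (1.89) p.387.
-/

noncomputable section

open MeasureTheory
open scoped BigOperators

namespace Summit.QuantumFields.YangMills.BalabanUVNodes.N13U1StepRRatioRowAtRecord13CoPH

open Literature.MathematicalPhysics.QuantumFieldTheory.Balaban1983to89
open T4Continuum Node00 B14.Eq218Concrete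
open Summit.QuantumFields.YangMills.BalabanUVNodes.N13U1StepMajorantTowerAtRecord13CoPH
  (abs_histTerm_le_of_majorantTower abs_histTerm₁₃_le_of_majorantTower)
open Summit.QuantumFields.YangMills.BalabanUVNodes.N13UVRowRFreeAtLiveSelectorRecord13
  (slotsOfRecord₁₃_succ_le_slotsT_of_liveSel wOfRecord₉_nonneg)

/-! ## §1. The post-𝐑 slot = the pre-𝐑 slot × the (0.3) ratio sum, by name; singleton fibres; off-range histories -/

section Generic

variable (F : T4Family) (N : ℕ) [NeZero N] (ν : Stage7Numerics) (τ : TowerNumerics)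
variable (E : B12.RunParams → ℝ) (w : StepWeightsOfRecord F N ν τ.M) (ppSel : PpSelOfRecord F ν τ.M) (p : B12.RunParams) (g : ℕ → ℝ)

/-- `|x ∕ x| ≤ 1` in `ℝ` (the value is `0` or `1`). [folklore] -/
theorem abs_div_self_le_one (x : ℝ) : |x / x| ≤ 1 := by
  rcases eq_or_ne x 0 with h | h
  · rw [h, div_zero, abs_zero]; exact zero_le_one
  · rw [div_self h, abs_one]

open Classical in
/-- **★★ [IV] (0.3) ON THE SLOTS OF RECORD, BY NAME** (`rfl`): the post-𝐑 slot at level `k+1` IS the pre-𝐑 slot times the RATIO SUM over the selector fibre —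
`slot_{k+1}(s′)(V) = slotT_{k+1}(s′)(V) · Σ_{a : sel(a) = s′} rratio(a, s′)(V)`, `rratio(a, s′)(V) = ∫⌈_{fib a} t_a ∕ ∫⌈_{fib a} t_{s′}` for the (2.18) slice of the pre-𝐑 slots (def-T
`slotsOfRecord_succ`; def-R `rstepSlotOfRecord` ∕ `rstepSlot` ∕ `rstepOfSel_TexpA`, whose classical `DecidableEq` instance on the bonds is displayed explicitly). [cite: Balaban1989LargeFieldI, (0.3) p.176; Balaban1988Convergent, Thm 1 p.262 («has again the form (2.18)»)] -/
theorem slotsOfRecord_succ_eq_mul_rratioSum (k : ℕ) (s' : SeqOfRecord F ν τ.M g p.K (k + 1)) (V : GaugeField (F.P p.K) (k + 1) (SU N)) :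
    slotsOfRecord F N ν τ E w ppSel p g (k + 1) s' V =
      slotsTOfRecord F N ν τ E w ppSel p g (k + 1) s' V *
        ∑ a ∈ Finset.univ.filter (fun a => ppSel p g (k + 1) a = s'),
          @rratio (F.P p.K) (SU N) _ _ _ (k + 1) (fun a b => Classical.propDecidable (a = b))
            (sliceOfRecord F N ν τ.M p g (k + 1) (slotsTOfRecord F N ν τ E w ppSel p g (k + 1)))
            (fibOfSeq F ν τ p g (k + 1)) a s' V := by
  rw [slotsOfRecord_succ]
  rfl

open Classical in
/-- **THE 𝐑-RATIO ROW HOLDS WITH EQUALITY** for `c_R(s′)(V) := |Σ_{a : sel(a) = s′} rratio(a, s′)(V)|`. [cite: Balaban1989LargeFieldI, (0.3) p.176 (bookkeeping)] -/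
theorem abs_slotsOfRecord_succ_eq (k : ℕ) (s' : SeqOfRecord F ν τ.M g p.K (k + 1)) (V : GaugeField (F.P p.K) (k + 1) (SU N)) :
    |slotsOfRecord F N ν τ E w ppSel p g (k + 1) s' V| =
      |∑ a ∈ Finset.univ.filter (fun a => ppSel p g (k + 1) a = s'),
          @rratio (F.P p.K) (SU N) _ _ _ (k + 1) (fun a b => Classical.propDecidable (a = b))
            (sliceOfRecord F N ν τ.M p g (k + 1) (slotsTOfRecord F N ν τ E w ppSel p g (k + 1)))
            (fibOfSeq F ν τ p g (k + 1)) a s' V| *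
        |slotsTOfRecord F N ν τ E w ppSel p g (k + 1) s' V| := by
  rw [slotsOfRecord_succ_eq_mul_rratioSum, abs_mul, mul_comm]

open Classical in
/-- **NON-RENORMALISED HISTORIES**: if the selector fibre of `s′` is the singleton `{s′}` (nothing is merged into `s′` at this step and `s′` is kept), the ratio sum is `rratio(s′, s′) = x ∕ x`,
so `|slot_{k+1}(s′)(V)| ≤ |slotT_{k+1}(s′)(V)|` — the 𝐑-ratio row with `c_R = 1` (the finer live-selector statement, where the fibre may also contain DEAD sequences of zero fibre mass, is
dag-n13-w1 g4's `rstepOfSel_TexpA_eq_id_of_fix_of_dead` ∕ `slotsOfRecord₁₃_succ_le_slotsT_of_liveSel`, cited in §3). [cite: Balaban1989LargeFieldI, (0.3) p.176, p.177 (i)–(ii) (bookkeeping: the `Z″ = Z` terms)] -/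
theorem abs_slotsOfRecord_succ_le_of_fibre_singleton (k : ℕ) (s' : SeqOfRecord F ν τ.M g p.K (k + 1))
    (hfib : ∀ a, ppSel p g (k + 1) a = s' ↔ a = s') (V : GaugeField (F.P p.K) (k + 1) (SU N)) :
    |slotsOfRecord F N ν τ E w ppSel p g (k + 1) s' V| ≤ 1 * |slotsTOfRecord F N ν τ E w ppSel p g (k + 1) s' V| := by
  rw [abs_slotsOfRecord_succ_eq]
  refine mul_le_mul_of_nonneg_right ?_ (abs_nonneg _)
  have hfilter : Finset.univ.filter (fun a => ppSel p g (k + 1) a = s') = {s'} := by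
    ext a
    simp only [Finset.mem_filter, Finset.mem_univ, true_and, Finset.mem_singleton]
    exact hfib a
  rw [hfilter, Finset.sum_singleton]
  exact abs_div_self_le_one _

/-! ## §2. The majorant tower with the 𝐑-row DISCHARGED by definition (`c_R := |Σ rratio|`) -/

open Classical in
/-- **★★★ THE MAJORANT TOWER, 𝐑-ROW DISCHARGED** (generic over the represented tower of record): with `c_R(s′)(V′) := |Σ_{a : sel(a) = s′} rratio(a, s′)(V′)|` the companion's tower needs only
the base `ρ₀ ≤ M_0`, the `w`-rows and the STEP ROWS `χ_{j+1}(s′)(V′) · |Σ rratio|(V′) · T_j(|w_j(s′)(·,V′)| · M_j(init s′))(V′) ≤ M_{j+1}(s′)(V′)` (`j < k`) to bound every level-`k` history term: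
`|χ_k(s)·slot_k(s)| ≤ M_k(s)`.  The step rows are DISPLAYED ([III] §3 ∕ (2.49), [IV] §1 ratio bounds, [B16] (1.89)); nothing of Bałaban's asserted. [cite: Balaban1989LargeFieldI, (0.3) p.176, (1.99)–(1.100) p.201; Balaban1988Convergent, (2.49) p.264; Balaban1989LargeFieldII, (1.89) p.387] -/
theorem abs_histTerm_le_of_majorantTower_rratio (k : ℕ)
    (M : (j : ℕ) → SeqOfRecord F ν τ.M g p.K j → GaugeField (F.P p.K) j (SU N) → ℝ)
    (h0 : ∀ (s : SeqOfRecord F ν τ.M g p.K 0) U, rhoZeroOfRecord F N p.K (g 0) (E p) U ≤ M 0 s U)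
    (hMm : ∀ j, j < k → ∀ s, Measurable (M j s))
    (hMC : ∀ j, j < k → ∀ s, ∃ C : ℝ, ∀ U, M j s U ≤ C)
    (hw : ∀ j, j < k → ∀ (s' : SeqOfRecord F ν τ.M g p.K (j + 1)) (V' : GaugeField (F.P p.K) (j + 1) (SU N)),
      Measurable fun U : GaugeField (F.P p.K) j (SU N) => w p g j s' U V')
    (hwb : ∀ j, j < k → ∀ (s' : SeqOfRecord F ν τ.M g p.K (j + 1)) U V', |w p g j s' U V'| ≤ 1)
    (hstep : ∀ j, j < k → ∀ (s' : SeqOfRecord F ν τ.M g p.K (j + 1)) V',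
      chiSeqOfRecord F N ν τ.M g p.K (j + 1) s' V' *
        |∑ a ∈ Finset.univ.filter (fun a => ppSel p g (j + 1) a = s'),
          @rratio (F.P p.K) (SU N) _ _ _ (j + 1) (fun a b => Classical.propDecidable (a = b))
            (sliceOfRecord F N ν τ.M p g (j + 1) (slotsTOfRecord F N ν τ E w ppSel p g (j + 1)))
            (fibOfSeq F ν τ p g (j + 1)) a s' V'| *
        transportOfRecord F N p.K j (fun U => |w p g j s' U V'| * M j s'.init U) V' ≤ M (j + 1) s' V') :
    ∀ (s : SeqOfRecord F ν τ.M g p.K k) U,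
      |chiSeqOfRecord F N ν τ.M g p.K k s U * slotsOfRecord F N ν τ E w ppSel p g k s U| ≤ M k s U :=
  abs_histTerm_le_of_majorantTower F N ν τ E w ppSel p g k M
    (fun j s' V' => match j with
      | 0 => 0
      | j + 1 => |∑ a ∈ Finset.univ.filter (fun a => ppSel p g (j + 1) a = s'),
          @rratio (F.P p.K) (SU N) _ _ _ (j + 1) (fun a b => Classical.propDecidable (a = b))
            (sliceOfRecord F N ν τ.M p g (j + 1) (slotsTOfRecord F N ν τ E w ppSel p g (j + 1)))
            (fibOfSeq F ν τ p g (j + 1)) a s' V'|)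
    h0 hMm hMC hw hwb (fun _ _ _ _ => abs_nonneg _)
    (fun j _ s' V' => (abs_slotsOfRecord_succ_eq F N ν τ E w ppSel p g j s' V').le) hstep

end Generic

/-! ## §3. AT K1⁷'s RECORD: the tower with the 𝐑-row discharged and the `w`-rows from `Provisos₁₃CoPH` -/

section AtRecord

variable (F : T4Family) (N : ℕ) [NeZero N]
variable (θ : Stage13HParams F N) (P : B12.RunParams)

open Classical in
/-- **★★★ THE MAJORANT TOWER AT THE STAGE-13 RECORD, 𝐑-ROW DISCHARGED**: every level-`k` history term of `densOfRecord₁₃` (`k ≤ K`) is bounded by `M_k` from the base `ρ₀ ≤ M_0` and the STEP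
ROWS alone — `χ_{j+1}(s′)(V′) · |Σ_{a : θ.ppSel(a) = s′} rratio(a, s′)(V′)| · T_j(|w_j(s′)(·,V′)| · M_j(init s′))(V′) ≤ M_{j+1}(s′)(V′)`, `j < k` (the `w`-rows are def-T's `Provisos₁₃CoPH.tstep`;
the (0.3) ratio sum is def-R's, by name).  These rows ARE the displayed analytic content of the (U1) leaf ([III] §3 ∕ (2.49), [IV] §1, [B16] (1.89)) — LOCATED, nobody's theorem here.
[cite: Balaban1989LargeFieldI, (0.3) p.176, (1.99)–(1.100) p.201; Balaban1988Convergent, (2.49) p.264, (3.25) p.270; Balaban1989LargeFieldII, (1.89) p.387] -/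
theorem abs_histTerm₁₃_le_of_majorantTower_rratio (h : θ.Provisos₁₃CoPH F N) (k : ℕ) (hk : k ≤ P.K)
    (M : (j : ℕ) → SeqOfRecord F θ.ν θ.τ9.M (gOfRecord₁₃ F N θ.toStage13Params P) P.K j → GaugeField (F.P P.K) j (SU N) → ℝ)
    (h0 : ∀ (s : SeqOfRecord F θ.ν θ.τ9.M (gOfRecord₁₃ F N θ.toStage13Params P) P.K 0) U,
      rhoZeroOfRecord F N P.K (gOfRecord₁₃ F N θ.toStage13Params P 0) (EOfRecord₁₃ F N θ.toStage13Params P) U ≤ M 0 s U)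
    (hMm : ∀ j, j < k → ∀ s, Measurable (M j s))
    (hMC : ∀ j, j < k → ∀ s, ∃ C : ℝ, ∀ U, M j s U ≤ C)
    (hstep : ∀ j, j < k → ∀ (s' : SeqOfRecord F θ.ν θ.τ9.M (gOfRecord₁₃ F N θ.toStage13Params P) P.K (j + 1)) V',
      chiSeqOfRecord F N θ.ν θ.τ9.M (gOfRecord₁₃ F N θ.toStage13Params P) P.K (j + 1) s' V' *
        |∑ a ∈ Finset.univ.filter (fun a => θ.ppSel P (gOfRecord₁₃ F N θ.toStage13Params P) (j + 1) a = s'),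
          @rratio (F.P P.K) (SU N) _ _ _ (j + 1) (fun a b => Classical.propDecidable (a = b))
            (sliceOfRecord F N θ.ν θ.τ9.M P (gOfRecord₁₃ F N θ.toStage13Params P) (j + 1)
              (slotsTOfRecord F N θ.ν θ.τ9 (EOfRecord₁₃ F N θ.toStage13Params) (wOfRecord₉ F N θ.toStage9Params) θ.ppSel P
                (gOfRecord₁₃ F N θ.toStage13Params P) (j + 1)))
            (fibOfSeq F θ.ν θ.τ9 P (gOfRecord₁₃ F N θ.toStage13Params P) (j + 1)) a s' V'| *
        transportOfRecord F N P.K j (fun U => |wOfRecord₉ F N θ.toStage9Params P (gOfRecord₁₃ F N θ.toStage13Params P) j s' U V'| * M j s'.init U) V'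
          ≤ M (j + 1) s' V') :
    ∀ (s : SeqOfRecord F θ.ν θ.τ9.M (gOfRecord₁₃ F N θ.toStage13Params P) P.K k) U,
      |chiSeqOfRecord F N θ.ν θ.τ9.M (gOfRecord₁₃ F N θ.toStage13Params P) P.K k s U *
        slotsOfRecord F N θ.ν θ.τ9 (EOfRecord₁₃ F N θ.toStage13Params) (wOfRecord₉ F N θ.toStage9Params) θ.ppSel P
          (gOfRecord₁₃ F N θ.toStage13Params P) k s U| ≤ M k s U :=
  abs_histTerm₁₃_le_of_majorantTower F N θ P h k hk M
    (fun j s' V' => match j with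
      | 0 => 0
      | j + 1 => |∑ a ∈ Finset.univ.filter (fun a => θ.ppSel P (gOfRecord₁₃ F N θ.toStage13Params P) (j + 1) a = s'),
          @rratio (F.P P.K) (SU N) _ _ _ (j + 1) (fun a b => Classical.propDecidable (a = b))
            (sliceOfRecord F N θ.ν θ.τ9.M P (gOfRecord₁₃ F N θ.toStage13Params P) (j + 1)
              (slotsTOfRecord F N θ.ν θ.τ9 (EOfRecord₁₃ F N θ.toStage13Params) (wOfRecord₉ F N θ.toStage9Params) θ.ppSel P
                (gOfRecord₁₃ F N θ.toStage13Params P) (j + 1)))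
            (fibOfSeq F θ.ν θ.τ9 P (gOfRecord₁₃ F N θ.toStage13Params P) (j + 1)) a s' V'|)
    h0 hMm hMC (fun _ _ _ _ => abs_nonneg _)
    (fun j _ s' V' => (abs_slotsOfRecord_succ_eq F N θ.ν θ.τ9 (EOfRecord₁₃ F N θ.toStage13Params) (wOfRecord₉ F N θ.toStage9Params) θ.ppSel P
      (gOfRecord₁₃ F N θ.toStage13Params P) j s' V').le) hstep


/-- **★★★ AT A LIVE-SELECTOR PARAMETER THE TOWER NEEDS THE 𝐓-STEP ROWS ALONE** (dag-n13-w1 g4's 𝐑-freeness, by name): if `θ.ppSel` IS K0a's live selector of record (`hsel`; every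
`liveRepin₁₃`, every K1 witness), then under `Provisos₁₃CoPH` (ζ-laws ⟹ `w ≥ 0` ⟹ slots `≥ 0`, K0's `slotsOfRecord_nonneg`; `0 ≤ slot_{j+1} ≤ slotT_{j+1}`, `slotsOfRecord₁₃_succ_le_slotsT_of_liveSel`)
the 𝐑-ratio row holds with `c_R = 1`, and every level-`k` history term of `densOfRecord₁₃` (`k ≤ K`) is bounded by `M_k` from the base `ρ₀ ≤ M_0` and the 𝐓-STEP ROWS
`χ_{j+1}(s′)(V′) · T_j(|w_j(s′)(·,V′)| · M_j(init s′))(V′) ≤ M_{j+1}(s′)(V′)` (`j < k`; `|w| = w` here) — the (U1) leaf at these parameters is priced by the 𝐓-image only ([III] §3 ∕ (2.49),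
[B16] (1.89)); DISPLAYED, LOCATED; nothing of Bałaban's asserted. [cite: Balaban1989LargeFieldI, (0.3) p.176, p.177 (i)–(ii); Balaban1988Convergent, (2.49) p.264, (3.24)–(3.25) p.270; Balaban1989LargeFieldII, (1.89) p.387] -/
theorem abs_histTerm₁₃_le_of_tstepRows_of_liveSel (h : θ.Provisos₁₃CoPH F N)
    (hsel : θ.toStage13Params.ppSel = ppSelLiveOfRecord F N θ.ν θ.τ9 (EOfRecord₁₃ F N θ.toStage13Params) (wOfRecord₉ F N θ.toStage9Params))
    (k : ℕ) (hk : k ≤ P.K)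
    (M : (j : ℕ) → SeqOfRecord F θ.ν θ.τ9.M (gOfRecord₁₃ F N θ.toStage13Params P) P.K j → GaugeField (F.P P.K) j (SU N) → ℝ)
    (h0 : ∀ (s : SeqOfRecord F θ.ν θ.τ9.M (gOfRecord₁₃ F N θ.toStage13Params P) P.K 0) U,
      rhoZeroOfRecord F N P.K (gOfRecord₁₃ F N θ.toStage13Params P 0) (EOfRecord₁₃ F N θ.toStage13Params P) U ≤ M 0 s U)
    (hMm : ∀ j, j < k → ∀ s, Measurable (M j s))
    (hMC : ∀ j, j < k → ∀ s, ∃ C : ℝ, ∀ U, M j s U ≤ C)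
    (hstep : ∀ j, j < k → ∀ (s' : SeqOfRecord F θ.ν θ.τ9.M (gOfRecord₁₃ F N θ.toStage13Params P) P.K (j + 1)) V',
      chiSeqOfRecord F N θ.ν θ.τ9.M (gOfRecord₁₃ F N θ.toStage13Params P) P.K (j + 1) s' V' *
        transportOfRecord F N P.K j (fun U => |wOfRecord₉ F N θ.toStage9Params P (gOfRecord₁₃ F N θ.toStage13Params P) j s' U V'| * M j s'.init U) V'
          ≤ M (j + 1) s' V') :
    ∀ (s : SeqOfRecord F θ.ν θ.τ9.M (gOfRecord₁₃ F N θ.toStage13Params P) P.K k) U,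
      |chiSeqOfRecord F N θ.ν θ.τ9.M (gOfRecord₁₃ F N θ.toStage13Params P) P.K k s U *
        slotsOfRecord F N θ.ν θ.τ9 (EOfRecord₁₃ F N θ.toStage13Params) (wOfRecord₉ F N θ.toStage9Params) θ.ppSel P
          (gOfRecord₁₃ F N θ.toStage13Params P) k s U| ≤ M k s U := by
  have hw0 := wOfRecord₉_nonneg θ.toStage13Params h.zetaUnity h.zetaAbs
  refine abs_histTerm₁₃_le_of_majorantTower F N θ P h k hk M (fun _ _ _ => 1) h0 hMm hMC (fun _ _ _ _ => zero_le_one) ?_ ?_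
  · -- the 𝐑-ratio row with `c_R = 1`: `0 ≤ slot_{j+1} ≤ slotT_{j+1}` at the live selector
    intro j hj s' V'
    have hle := slotsOfRecord₁₃_succ_le_slotsT_of_liveSel θ.toStage13Params h.zetaUnity h.zetaAbs hsel P j s' V'
    have h0s := slotsOfRecord_nonneg F N θ.ν θ.τ9 (EOfRecord₁₃ F N θ.toStage13Params) hw0 θ.ppSel P
      (gOfRecord₁₃ F N θ.toStage13Params P) (j + 1) s' V'
    rw [abs_of_nonneg h0s, abs_of_nonneg (h0s.trans hle), one_mul]
    exact hle
  · intro j hj s' V'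
    simpa only [mul_one] using hstep j hj s' V'

end AtRecord

end Summit.QuantumFields.YangMills.BalabanUVNodes.N13U1StepRRatioRowAtRecord13CoPH

end
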